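import Mathlib
import HarnessLib
import Literature.Probability.MarkovChains.MetropolisHastings

/-!
# The correlated pseudo-marginal algorithm (Deligiannidis–Doucet–Pitt): a Metropolis–Hastings chain
# on (parameter, noise) whose acceptance involves neither the noise law `m` nor the noise kernel `K`

Topic `Probability/MarkovChains`.  PUBLISHED RESULT with our formalisation; no named fact (two
definitions with bodies — the extended target and the product proposal — and theorems).  Sequel of
`MetropolisHastings.lean` (`mhRate`, `mhKernel`, `mhKernel_isStationary`) and companion of
`PseudoMarginal.lean` (the PM chain, which is the special case `K(u, u′) = m(u′)` below).  Wanted by the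
cell pub-lqcd (venture `LatticeQCDFlow`, HOME/R2-SCOPE.md §3 E2 class D2 "PSEUDO-MARGINAL: an unbiased
non-negative estimator `p̂(U′)` computed ONCE when `U′` is proposed and RE-USED": the correlated scheme
keeps the auxiliary noise `u` — for pseudofermions, the Gaussian source — as part of the state and
refreshes it by ANY `m`-reversible move, e.g. the Crank–Nicolson update `u′ = ρu + √(1−ρ²)ξ`; exactness
is "by construction" a Metropolis–Hastings statement on the extended space, proved here; FANOUT row 38).

## Source and the printed statement

G. Deligiannidis, A. Doucet, M. K. Pitt, *The correlated pseudo-marginal method*, J. R. Stat. Soc. B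
80 (2018) 839–870 = arXiv:1511.04992 [DeligiannidisDoucetPitt2018], §2.1–§2.2 (materialised text
`paper:arxiv-1511.04992`, chunk p0005):

> (2.1) `r_EX(θ, θ′) = π(θ′)q(θ′, θ)/(π(θ)q(θ, θ′)) = p(y|θ′)p(θ′)q(θ′, θ)/(p(y|θ)p(θ)q(θ, θ′))` …
> (2.2) Assume `p̂(y|θ, U)` is a non-negative unbiased estimator of the intractable likelihood `p(y|θ)`
> when `U ∼ m` … introduce the joint density `π̄(θ, u) = π(θ)m(u)p̂(y|θ, u)/p(y|θ)` (3).  As `p̂(y|θ, U)` is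
> unbiased, `π̄(θ, u)` admits `π(θ)` as marginal density.  The CPM algorithm is a MH scheme targeting
> (3) with proposal density `q(θ, dθ′)K(u, du′)` where `K` admits an `m`-reversible Markov transition
> density, i.e. `m(u)K(u, u′) = m(u′)K(u′, u)` (4).  This yields the acceptance probability
> `α_Q{(θ, u), (θ′, u′)} = min{1, r_EX(θ, θ′)·[p̂(y|θ′, u′)/p(y|θ′)]/[p̂(y|θ, u)/p(y|θ)]}` (5).  Hence, the
> CPM algorithm admits `π̄(θ, u)` as an invariant density by construction … For `K(u, u′) = m(u′)`, we
> recover the PM algorithm.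

## What is proved (finite `Θ`, finite noise space `U`; real weights)

With prior `p`, likelihood estimate `p̂ : Θ → U → ℝ`, noise law `m`, parameter proposal `q`, noise
kernel `K`:
* `target p m p̂ (θ, u) = p θ · m u · p̂ θ u` — the extended target (3) up to the constant `1/p(y)`
  (`π(θ) ∝ p(θ)p(y|θ)`, so `π(θ)m(u)p̂/p(y|θ) ∝ p(θ)m(u)p̂(y|θ,u)`); `sum_target_eq` — **unbiasedness
  `Σ_u m(u)p̂(y|θ,u) = p(y|θ)` makes its `θ`-marginal the posterior weight `p(θ)p(y|θ)`**;
* `proposal q K (θ,u) (θ′,u′) = q θ θ′ · K u u′`;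
* **`mhRate_cpm`** — for an `m`-reversible `K` (4) and positive data, the Metropolis–Hastings rate of
  the tree for this (target, proposal) pair IS the printed CPM move probability
  `q(θ,θ′)K(u,u′)·min{1, p(θ′)p̂(y|θ′,u′)q(θ′,θ)/(p(θ)p̂(y|θ,u)q(θ,θ′))}` (5): the factors `m` and `K` CANCEL
  from the acceptance ratio by reversibility, although they are part of target and proposal;
* **`cpm_isStationary`** — the CPM chain (`mhKernel` of the pair) leaves `π̄` invariant, and
  `cpm_detailedBalance`;
* `pm_reversible` — the independent refresh `K(u,u′) = m(u′)` satisfies (4) ("we recover the PM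
  algorithm"), so `mhRate_cpm` specialises to the PM acceptance (`mhRate_pm`);
* `blockRefresh`, `blockRefresh_reversible` — the block pseudo-marginal refresh of Tran–Kohn–Quiroz–Villani
  (redraw ONE block of the random numbers from its law, keep the rest) is reversible for the product law,
  hence another instance of (4) [TranKohnQuirozVillani2016, §2.2].

Scope (honest): finite spaces (the source works with densities on `Θ × ℝ^M` and the Crank–Nicolson
kernel `K_ρ`; only the algebra of (3)–(5) is formalised, for any reversible `K`); nothing about the
scaling limit, the choice of `ρ`, or efficiency (§§3–5 of the source).

## References

* [DeligiannidisDoucetPitt2018] G. Deligiannidis, A. Doucet, M. K. Pitt, The correlated pseudo-marginal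
  method, J. R. Stat. Soc. B 80 (2018) 839–870, §2.2 eqs. (3)–(5).
* [TranKohnQuirozVillani2016] M.-N. Tran, R. Kohn, M. Quiroz, M. Villani, Block-wise pseudo-marginal
  Metropolis–Hastings, arXiv:1603.02485, §2.1–§2.2 (held text `paper:arxiv-1603.02485`, chunk p0005).
-/

noncomputable section

namespace Literature.Probability.MarkovChains

namespace CorrelatedPseudoMarginal

open Finset

variable {Θ U : Type*} [Fintype Θ] [DecidableEq Θ] [Fintype U] [DecidableEq U]

/-- The extended CPM target `π̄(θ, u) ∝ p(θ) m(u) p̂(y|θ, u)` (eq. (3) times the constant `p(y)`).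
[cite: DeligiannidisDoucetPitt2018, §2.2 eq. (3)] -/
def target (p : Θ → ℝ) (m : U → ℝ) (ph : Θ → U → ℝ) (x : Θ × U) : ℝ := p x.1 * m x.2 * ph x.1 x.2

/-- The CPM proposal `q(θ, θ′) K(u, u′)` on the extended space.
[cite: DeligiannidisDoucetPitt2018, §2.2 (proposal density q(θ,dθ′)K(u,du′))] -/
def proposal (q : Θ → Θ → ℝ) (K : U → U → ℝ) (x y : Θ × U) : ℝ := q x.1 y.1 * K x.2 y.2

variable {p : Θ → ℝ} {m : U → ℝ} {ph : Θ → U → ℝ} {py : Θ → ℝ} {q : Θ → Θ → ℝ} {K : U → U → ℝ}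

omit [Fintype Θ] [DecidableEq Θ] [DecidableEq U] in
/-- **Unbiasedness gives the right marginal**: if `Σ_u m(u) p̂(y|θ, u) = p(y|θ)` for every `θ`, the
`θ`-marginal of the extended target is the posterior weight `p(θ) p(y|θ)`.
[cite: DeligiannidisDoucetPitt2018, §2.2 ("As p̂(y|θ,U) is unbiased, π̄(θ,u) admits π(θ) as marginal density")] -/
theorem sum_target_eq (hunb : ∀ θ, ∑ u, m u * ph θ u = py θ) (θ : Θ) :
    ∑ u, target p m ph (θ, u) = p θ * py θ := by
  simp only [target, mul_assoc, ← mul_sum, hunb]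

omit [Fintype Θ] [DecidableEq Θ] [Fintype U] [DecidableEq U] in
/-- **The CPM acceptance (5): `m` and `K` cancel.**  For an `m`-reversible noise kernel
(`m(u)K(u,u′) = m(u′)K(u′,u)`, eq. (4)) and positive prior, noise law and likelihood estimates, the
Metropolis–Hastings rate of the pair (extended target, product proposal) from `(θ, u)` to `(θ′, u′)` is
`q(θ,θ′)K(u,u′) · min{1, p(θ′)p̂(y|θ′,u′)q(θ′,θ) / (p(θ)p̂(y|θ,u)q(θ,θ′))}` — the printed
`α_Q = min{1, r_EX · [p̂′/p(y|θ′)]/[p̂/p(y|θ)]}` with `r_EX = p(y|θ′)p(θ′)q(θ′,θ)/(p(y|θ)p(θ)q(θ,θ′))`, in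
which `p(y|·)` has cancelled as well.
[cite: DeligiannidisDoucetPitt2018, §2.2 eqs. (4)–(5)] -/
theorem mhRate_cpm (hrev : ∀ u u', m u * K u u' = m u' * K u' u) (hp : ∀ θ, 0 < p θ)
    (hm : ∀ u, 0 < m u) (hph : ∀ θ u, 0 < ph θ u) (hq : ∀ θ θ', 0 ≤ q θ θ') (hK : ∀ u u', 0 ≤ K u u')
    (θ θ' : Θ) (u u' : U) :
    mhRate (proposal q K) (target p m ph) (θ, u) (θ', u') =
      q θ θ' * K u u' * min 1 (p θ' * ph θ' u' * q θ' θ / (p θ * ph θ u * q θ θ')) := by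
  unfold mhRate proposal target
  dsimp only
  have hx : 0 < p θ * m u * ph θ u := mul_pos (mul_pos (hp θ) (hm u)) (hph θ u)
  by_cases hqz : q θ θ' = 0
  · -- no proposal mass: both sides vanish (the reverse rate carries the factor `K u' u`, but the
    -- forward proposal probability is zero)
    rw [hqz, zero_mul, zero_mul]
    refine min_eq_left ?_
    exact div_nonneg (mul_nonneg (mul_nonneg (mul_nonneg (hp θ').le (hm u').le) (hph θ' u').le)
      (mul_nonneg (hq θ' θ) (hK u' u))) hx.le
  have hqpos : 0 < q θ θ' := lt_of_le_of_ne (hq θ θ') (Ne.symm hqz)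
  have hT : 0 ≤ q θ θ' * K u u' := mul_nonneg (hq θ θ') (hK u u')
  -- reversibility moves `K u' u` to `K u u'`
  have hKuu : m u' * K u' u = m u * K u u' := (hrev u u').symm
  have hden1 : p θ * m u * ph θ u ≠ 0 := hx.ne'
  have hden2 : p θ * ph θ u * q θ θ' ≠ 0 := (mul_pos (mul_pos (hp θ) (hph θ u)) hqpos).ne'
  have key : p θ' * m u' * ph θ' u' * (q θ' θ * K u' u) / (p θ * m u * ph θ u) =
      q θ θ' * K u u' * (p θ' * ph θ' u' * q θ' θ / (p θ * ph θ u * q θ θ')) := by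
    calc p θ' * m u' * ph θ' u' * (q θ' θ * K u' u) / (p θ * m u * ph θ u)
        = p θ' * ph θ' u' * q θ' θ * (m u' * K u' u) / (p θ * m u * ph θ u) := by ring
      _ = p θ' * ph θ' u' * q θ' θ * (m u * K u u') / (p θ * m u * ph θ u) := by rw [hKuu]
      _ = q θ θ' * K u u' * (p θ' * ph θ' u' * q θ' θ / (p θ * ph θ u * q θ θ')) := by
          rw [mul_div_assoc', div_eq_div_iff hden1 hden2]
          ring
  rw [key, mul_min_of_nonneg _ _ hT, mul_one]

omit [Fintype U] [DecidableEq U] [Fintype Θ] [DecidableEq Θ] in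
/-- The extended target is positive for positive data. [cite: DeligiannidisDoucetPitt2018, §2.2 eq. (3)] -/
theorem target_pos (hp : ∀ θ, 0 < p θ) (hm : ∀ u, 0 < m u) (hph : ∀ θ u, 0 < ph θ u)
    (x : Θ × U) : 0 < target p m ph x :=
  mul_pos (mul_pos (hp x.1) (hm x.2)) (hph x.1 x.2)

/-- **The CPM chain is exact**: the extended target `π̄` is in detailed balance with the
Metropolis–Hastings kernel of the pair (extended target, product proposal) — whose off-diagonal rates
are the printed CPM move probabilities (`mhRate_cpm`) — for every noise kernel `K`.
[cite: DeligiannidisDoucetPitt2018, §2.2 ("the CPM algorithm admits π̄(θ,u) as an invariant density by construction")] -/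
theorem cpm_detailedBalance (hp : ∀ θ, 0 < p θ) (hm : ∀ u, 0 < m u) (hph : ∀ θ u, 0 < ph θ u) :
    DetailedBalance (target p m ph) (mhKernel (proposal q K) (target p m ph)) :=
  mhKernel_detailedBalance (target_pos hp hm hph) _

/-- **Invariance**: `π̄` is a stationary distribution of the CPM chain; by `sum_target_eq` its
`θ`-marginal is the posterior weight. [cite: DeligiannidisDoucetPitt2018, §2.2 (eqs. (3)–(5))] -/
theorem cpm_isStationary (hp : ∀ θ, 0 < p θ) (hm : ∀ u, 0 < m u) (hph : ∀ θ u, 0 < ph θ u) :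
    IsStationary (target p m ph) (mhKernel (proposal q K) (target p m ph)) :=
  mhKernel_isStationary (target_pos hp hm hph) _

omit [Fintype U] [DecidableEq U] [Fintype Θ] [DecidableEq Θ] in
/-- **"For `K(u, u′) = m(u′)` we recover the PM algorithm"**: the independent refresh is
`m`-reversible, so `mhRate_cpm` applies to the pseudo-marginal chain with a fresh noise draw.
[cite: DeligiannidisDoucetPitt2018, §2.2 (last sentence before the Gaussian specialisation)] -/
theorem pm_reversible (m : U → ℝ) (u u' : U) : m u * (fun _ v => m v) u u' = m u' * (fun _ v => m v) u' u := by
  simp only [mul_comm]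

omit [Fintype U] [DecidableEq U] [Fintype Θ] [DecidableEq Θ] in
/-- The PM acceptance as the special case `K(u,u′) = m(u′)`:
`q(θ,θ′) m(u′) · min{1, p(θ′)p̂(y|θ′,u′)q(θ′,θ)/(p(θ)p̂(y|θ,u)q(θ,θ′))}`.
[cite: DeligiannidisDoucetPitt2018, §2.2 eq. (5) with K(u,u′) = m(u′)] -/
theorem mhRate_pm (hp : ∀ θ, 0 < p θ) (hm : ∀ u, 0 < m u) (hph : ∀ θ u, 0 < ph θ u)
    (hq : ∀ θ θ', 0 ≤ q θ θ') (θ θ' : Θ) (u u' : U) :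
    mhRate (proposal q fun _ v => m v) (target p m ph) (θ, u) (θ', u') =
      q θ θ' * m u' * min 1 (p θ' * ph θ' u' * q θ' θ / (p θ * ph θ u * q θ θ')) :=
  mhRate_cpm (pm_reversible m) hp hm hph hq (fun _ v => (hm v).le) θ θ' u u'

/-! ## Block pseudo-marginal (Tran–Kohn–Quiroz–Villani): refreshing one block of the noise is `m`-reversible -/

section Block

variable {U₁ U₂ : Type*} [DecidableEq U₁] [DecidableEq U₂]

/-- The two-block refresh kernel of the block pseudo-marginal sampler: with probability `c` redraw the
first block of random numbers from its law `m₁` (keeping the second), with probability `1 − c` redraw the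
second from `m₂` (keeping the first). [cite: TranKohnQuirozVillani2016, §2.2 (update θ and just one block of the u_(j))] -/
def blockRefresh (c : ℝ) (m₁ : U₁ → ℝ) (m₂ : U₂ → ℝ) (u v : U₁ × U₂) : ℝ :=
  c * (m₁ v.1 * if v.2 = u.2 then 1 else 0) + (1 - c) * (m₂ v.2 * if v.1 = u.1 then 1 else 0)

/-- **The block refresh is reversible with respect to the product law `m₁ ⊗ m₂`** — so the block
pseudo-marginal sampler is a correlated pseudo-marginal chain in the sense of eq. (4), and
`mhRate_cpm` gives its acceptance `min{1, p(θ′)L̂(θ′,u′)q(θ′,θ)/(p(θ)L̂(θ,u)q(θ,θ′))}` — the printed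
acceptance of the block PM, which involves neither `m` nor the block choice.
[cite: TranKohnQuirozVillani2016, §2.2 (block PM proposal and acceptance probability)]
[cite: DeligiannidisDoucetPitt2018, §2.2 eq. (4)] -/
theorem blockRefresh_reversible (c : ℝ) (m₁ : U₁ → ℝ) (m₂ : U₂ → ℝ) (u v : U₁ × U₂) :
    (m₁ u.1 * m₂ u.2) * blockRefresh c m₁ m₂ u v = (m₁ v.1 * m₂ v.2) * blockRefresh c m₁ m₂ v u := by
  unfold blockRefresh
  by_cases h2 : v.2 = u.2 <;> by_cases h1 : v.1 = u.1
  · simp [h1, h2]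
  · simp [h1, h2, Ne.symm h1]; ring
  · simp [h1, h2, Ne.symm h2]; ring
  · simp [h1, h2, Ne.symm h1, Ne.symm h2]

end Block

end CorrelatedPseudoMarginal

end Literature.Probability.MarkovChains

end
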